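import Summits.ValiantsHypothesis.ValiantsHypothesis.Theorems.TwoAdicLadderTwoIntegralNormalisationOfHalfElim

/-!
# PROPOSED reshaped skeleton for line `birth` of crux `TwoIntegralNormalisation` (stmt-ValiantsHypothesis-5947)

Written by the stub prover of `stub_halfElim` (val-width-5947-p1 g0, 2026-08-27) as a SUGGESTION to the
line planner / lead (this seat does not register lines). Rationale (crux workfile `HALFELIM-CENSUS.md`):
the registered `stub_halfElim` (UNIFORM `1/2`-elimination, one `d` for all `n s`) is strictly stronger than
the composition needs and is NOT implied by `VP ≠ VNP`; the GLOBAL form below is VH-implied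
(`halfElimGlobal_of_valiantsHypothesis`, landed) and still closes the crux with the two LANDED stubs
(`stub_algConst` p573936, `stub_chainRingReduction` p573293) through the landed composition
`twoIntegralNormalisation_of_halfElimGlobal` (`Theorems/TwoAdicLadderTwoIntegralNormalisationOfHalfElim.lean`).

Stubs of the reshaped line:
* `stub_algConst` — LANDED (`…TwoIntegralNormalisationAlgConst.lean`), cited by name.
* `stub_halfElimGlobal` — OPEN, load-bearing (the only sorry): "if per has polynomial-size circuits over
  number fields (one exponent, every `n`) then for all large `n` some local ring `𝓞_(𝔭)`, `𝔭 ∋ 2`, of some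
  number field carries polynomial-size circuits for `per_n`". Vacuous under VH; open content =
  `1/2`-elimination (kernel: `PolyHeightCircuits ∧ PolyDivision`, see `…HalfElimKernel.lean`, `…PolyHeight.lean`).
* `stub_chainRingReduction` — LANDED (`…TwoIntegralNormalisationChainRingReduction.lean`), cited by name.
-/

set_option linter.dupNamespace false

namespace Summit.ValiantsHypothesis.ValiantsHypothesis.Cruxes.TwoIntegralNormalisation.Global

open Summit.ValiantsHypothesis.ValiantsHypothesis.Theses.TwoAdicLadder
open Summit.ValiantsHypothesis.ValiantsHypothesis.Theorems.TwoAdicLadder.TwoIntegralNormalisation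
open Literature.Computability.AlgebraicComplexity

/-- AlgConst (LANDED as `…Theorems.TwoAdicLadder.TwoIntegralNormalisation.stub_algConst`, p573936). -/
def AlgConst : Prop :=
  IsPComputable (fun n => perPoly (Fin n) ℂ) →
    ∃ a : ℕ, ∀ n : ℕ, ∃ (K : Type) (_ : Field K) (_ : NumberField K),
      complexity (perPoly (Fin n) K) ≤ n ^ a + a

/-- **HalfElimGlobal — the VH-implied global form of `1/2`-elimination** (proposed load-bearing stub). -/
def HalfElimGlobal : Prop :=
  (∃ a : ℕ, ∀ n : ℕ, ∃ (K : Type) (_ : Field K) (_ : NumberField K),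
      complexity (perPoly (Fin n) K) ≤ n ^ a + a) →
    ∃ b : ℕ, ∀ᶠ n in Filter.atTop, ∃ (K' : Type) (_ : Field K') (_ : NumberField K')
      (P : Ideal (NumberField.RingOfIntegers K')) (_ : P.IsPrime),
      (2 : NumberField.RingOfIntegers K') ∈ P ∧
      complexity (perPoly (Fin n) (Localization.AtPrime P)) ≤ n ^ b

/-- ChainRingReduction (LANDED as `…stub_chainRingReduction`, p573293). -/
def ChainRingReduction : Prop :=
  ∀ (K : Type) [Field K] [NumberField K] (P : Ideal (NumberField.RingOfIntegers K)) [P.IsPrime],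
    (2 : NumberField.RingOfIntegers K) ∈ P → ∀ k : ℕ,
      ∃ (R : Type) (_ : CommRing R) (_ : Fintype R),
        IsPrincipalIdealRing R ∧ IsNilpotent (2 : R) ∧ (2 : R) ^ k ≠ 0 ∧
        Nonempty (Localization.AtPrime P →+* R)

/-- Stub HalfElimGlobal (proposed obligation; signature = `HalfElimGlobal` verbatim). OPEN. -/
theorem stub_halfElimGlobal :
    (∃ a : ℕ, ∀ n : ℕ, ∃ (K : Type) (_ : Field K) (_ : NumberField K),
        complexity (perPoly (Fin n) K) ≤ n ^ a + a) →
      ∃ b : ℕ, ∀ᶠ n in Filter.atTop, ∃ (K' : Type) (_ : Field K') (_ : NumberField K')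
        (P : Ideal (NumberField.RingOfIntegers K')) (_ : P.IsPrime),
        (2 : NumberField.RingOfIntegers K') ∈ P ∧
        complexity (perPoly (Fin n) (Localization.AtPrime P)) ≤ n ^ b := by
  sorry

namespace Registered
/-- Alias (landed stub). -/
abbrev stub_algConst : Prop := AlgConst
/-- Alias (proposed stub). -/
abbrev stub_halfElimGlobal : Prop := HalfElimGlobal
/-- Alias (landed stub). -/
abbrev stub_chainRingReduction : Prop := ChainRingReduction
end Registered

/-- **Composition** — kernel-checked and sorry-free in the tree: the landed
`twoIntegralNormalisation_of_halfElimGlobal` (extension of scalars along `𝓞_(𝔭) → R`,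
`complexity_map_le`, `map_perPoly`). -/
theorem TwoIntegralNormalisation_of :
    Registered.stub_algConst → Registered.stub_halfElimGlobal → Registered.stub_chainRingReduction →
      TwoIntegralNormalisation :=
  fun hA hH hC => twoIntegralNormalisation_of_halfElimGlobal hA hC hH

/-- The VH-implication of the proposed stub (calibration: it cannot fail unless the summit does). -/
example : _root_.ValiantsHypothesis → HalfElimGlobal := halfElimGlobal_of_valiantsHypothesis

end Summit.ValiantsHypothesis.ValiantsHypothesis.Cruxes.TwoIntegralNormalisation.Global
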